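import Literature.AlgebraicTopology.SingularHomology.LocalDegreeLinearization
import Literature.AlgebraicTopology.SingularHomology.LocalHomologyUniverse
import Literature.AlgebraicTopology.SingularHomology.LocalHomologyCharts
import Literature.AlgebraicTopology.SingularHomology.BoundaryTransfer
import HarnessLib

/-!
# Local orientation classes along charts: change of chart is the sign of the Jacobian

For a space `X : Type u` charted over `𝔼 = EuclideanSpace ℝ (Fin n)` (any universe; `T₁`, as
every charted space is), a chart `c : OpenPartialHomeomorph X 𝔼` at `y` and a `ℤ`-orientation
`g` of `𝔼`, the **reference local class of `c` at `y`** is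
`(localHomology.chartXEquiv ℤ ℤ c hy n).symm (g (c y)) ∈ Hₙ(X | y; ℤ)` — the generator `g_{c y}`
pulled back along the cross-universe chart identification `Hₙ(X | y) ≃ Hₙ(𝔼 | c y)` of
`…LocalHomologyUniverse`. This file proves the two facts about these classes on which the
comparison of smooth and homological orientations rests (G. Bredon, *Topology and Geometry*
(1993), VI.7, Prop. 7.14–Thm. 7.15; J. Milnor, J. Stasheff, *Characteristic Classes* (1974),
Appendix A; A. Hatcher, *Algebraic Topology* (2002), §3.3 pp. 233–236):

* `chartXEquiv_restrOpen` — the identification only depends on the germ of the chart;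
* **`chartXEquiv_apply_chartXEquiv_symm`** — for two charts `c`, `c'` at `y` the composite
  `Hₙ(𝔼 | c' y) ≃ Hₙ(X | y) ≃ Hₙ(𝔼 | c y)` is the push-forward along the transition map
  `c ∘ c'⁻¹` from (an open part of) its source; hence, by the local degree theorem
  `HomologicalOrientation.localDegree_of_hasFDerivAt` of `…LocalDegreeLinearization`,
  **`chartXEquiv_symm_localClass_eq_of_hasFDerivAt`**: if the transition map is differentiable
  at `c' y` with Jacobian `A`, `det A ≠ 0`, the reference classes of `c'` and `c` at `y` agree
  if `det A > 0` and are opposite if `det A < 0`;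
* `exists_mem_nhds_restrictToPoint_eq_chartXEquiv_symm` — along a fixed chart the reference
  classes are locally the restrictions of one class `N ∈ Hₙ(X | K)` (no separation hypothesis);
* `HomologicalOrientation.eventually_localClass_eq_chartXEquiv_symm_iff` — on a Hausdorff `X`,
  whether a `ℤ`-orientation `μ` of `X` agrees with the reference classes of a fixed chart is
  locally constant (uniqueness of continuation, Hatcher Lemma 3.27).

Everything is proved; no definitions and no named facts are introduced.

## References

* G. E. Bredon, *Topology and Geometry*, GTM 139, Springer 1993, VI.7. [Bredon1993]
* J. Milnor, J. Stasheff, *Characteristic Classes*, Princeton 1974, Appendix A.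
  [MilnorStasheff1974]
* A. Hatcher, *Algebraic Topology*, CUP 2002, §3.3 pp. 231–236. [HatcherAT2002]
-/

noncomputable section

open CategoryTheory Limits Set Filter Topology

universe u

namespace Literature.AlgebraicTopology.SingularHomology

variable {n : ℕ}

/-! ### Generators of infinite cyclic groups: negation -/

section Generators

variable {N : Type*} [AddCommGroup N] [Module ℤ N]

/-- The negative of a generator of a `ℤ`-line is a generator. [folklore] -/
theorem isGenerator_neg {b : N} (hb : ∃ e : N ≃ₗ[ℤ] ℤ, e b = 1) : ∃ e : N ≃ₗ[ℤ] ℤ, e (-b) = 1 := by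
  obtain ⟨e, he⟩ := hb
  exact ⟨e.trans (LinearEquiv.neg ℤ), by simp [he]⟩

/-- A generator of a `ℤ`-line is not `2`-torsion: `-b ≠ b`. [folklore] -/
theorem neg_ne_self_of_isGenerator {b : N} (hb : ∃ e : N ≃ₗ[ℤ] ℤ, e b = 1) : -b ≠ b := by
  obtain ⟨e, he⟩ := hb
  intro h
  have := congrArg e h
  rw [map_neg, he] at this
  omega

/-- Two generators of a `ℤ`-line agree or are opposite (Hatcher 2002, §3.3 p. 235: the two
generators `± 1` of `ℤ`). [folklore] -/
theorem eq_or_eq_neg_of_isGenerator {a b : N} (ha : ∃ e : N ≃ₗ[ℤ] ℤ, e a = 1)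
    (hb : ∃ e : N ≃ₗ[ℤ] ℤ, e b = 1) : a = b ∨ a = -b := by
  obtain ⟨u, hu⟩ := exists_units_smul_eq_of_linearEquiv (LinearEquiv.refl ℤ N) ha hb
  rw [LinearEquiv.refl_apply] at hu
  rcases Int.units_eq_one_or u with rfl | rfl
  · left; rw [hu, Units.val_one, one_zsmul]
  · right; rw [hu, Units.val_neg, Units.val_one, neg_one_zsmul]

end Generators

/-! ### The chart identification only depends on the germ of the chart -/

section Charts

variable {X : Type u} [TopologicalSpace X] [T1Space X]

/-- **Shrinking the chart does not change the identification `Hₙ(X | y) ≃ Hₙ(𝔼 | c y)`**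
(`localHomology.chartXEquiv` of `…LocalHomologyUniverse`): for an open `W ∋ y` the chart
`c.restrOpen W` gives the same map (excision is transitive and the cross-universe transport is
natural, `relativeSingularHomology.xEquiv_map`). [folklore] -/
theorem chartXEquiv_restrOpen (c : OpenPartialHomeomorph X (EuclideanSpace ℝ (Fin n)))
    {W : Set X} (hW : IsOpen W) {y : X} (hy : y ∈ c.source) (hyW : y ∈ W) (k : ℕ)
    (z : localHomology ℤ ℤ X y k) :
    localHomology.chartXEquiv ℤ ℤ (c.restrOpen W hW) (show y ∈ (c.restrOpen W hW).source from
      ⟨hy, hyW⟩) k z = localHomology.chartXEquiv ℤ ℤ c hy k z := by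
  -- the four pairs
  set c₂ := c.restrOpen W hW with hc₂
  have hy₂ : y ∈ c₂.source := ⟨hy, hyW⟩
  let ι : C(↥c₂.source, ↥c.source) := ⟨Set.inclusion inter_subset_left,
    continuous_inclusion inter_subset_left⟩
  let ι' : C(↥c₂.target, ↥c.target) := ⟨Set.inclusion inter_subset_left,
    continuous_inclusion inter_subset_left⟩
  have hι : MapsTo ι {(⟨y, hy₂⟩ : ↥c₂.source)}ᶜ {(⟨y, hy⟩ : ↥c.source)}ᶜ := by
    intro v hv hv'
    apply hv
    rw [mem_singleton_iff] at hv' ⊢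
    have e1 : (v : X) = y := congrArg Subtype.val hv'
    exact Subtype.ext e1
  have hι' : MapsTo ι' {c₂.toHomeomorphSourceTarget ⟨y, hy₂⟩}ᶜ
      {c.toHomeomorphSourceTarget ⟨y, hy⟩}ᶜ := by
    intro v hv hv'
    apply hv
    rw [mem_singleton_iff] at hv' ⊢
    have e1 : (v : EuclideanSpace ℝ (Fin n)) = c y := congrArg Subtype.val hv'
    exact Subtype.ext e1
  -- excision is transitive: `exc_{S₂} = ι_* ≫ exc_S`, `exc_{T₂} = ι'_* ≫ exc_T`
  have hS : (localHomology.openSubsetIso ℤ ℤ c₂.open_source hy₂ k).hom =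
      relativeSingularHomology.map ℤ ℤ ι hι k ≫
        (localHomology.openSubsetIso ℤ ℤ c.open_source hy k).hom :=
    relativeSingularHomology.map_comp ℤ ℤ ι (subsetIncl c.source) hι
      (localHomology.mapsTo_subsetIncl_compl hy) k
  have hT : (localHomology.openSubsetIso ℤ ℤ c₂.open_target (c₂.map_source hy₂) k).hom =
      relativeSingularHomology.map ℤ ℤ ι' hι' k ≫
        (localHomology.openSubsetIso ℤ ℤ c.open_target (c.map_source hy) k).hom :=
    relativeSingularHomology.map_comp ℤ ℤ ι' (subsetIncl c.target) hι'
      (localHomology.mapsTo_subsetIncl_compl (c.map_source hy)) k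
  -- unfold both sides
  have eL : localHomology.chartXEquiv ℤ ℤ c₂ hy₂ k z =
      (localHomology.openSubsetIso ℤ ℤ c₂.open_target (c₂.map_source hy₂) k).hom
        (localHomology.xEquiv ℤ ℤ c₂.toHomeomorphSourceTarget ⟨y, hy₂⟩ k
          ((localHomology.openSubsetIso ℤ ℤ c₂.open_source hy₂ k).inv z)) := rfl
  have eR : localHomology.chartXEquiv ℤ ℤ c hy k z =
      (localHomology.openSubsetIso ℤ ℤ c.open_target (c.map_source hy) k).hom
        (localHomology.xEquiv ℤ ℤ c.toHomeomorphSourceTarget ⟨y, hy⟩ k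
          ((localHomology.openSubsetIso ℤ ℤ c.open_source hy k).inv z)) := rfl
  -- `exc_S.inv z = ι_* (exc_{S₂}.inv z)`
  have h1 : (localHomology.openSubsetIso ℤ ℤ c.open_source hy k).inv z =
      relativeSingularHomology.map ℤ ℤ ι hι k
        ((localHomology.openSubsetIso ℤ ℤ c₂.open_source hy₂ k).inv z) := by
    have e1 : (localHomology.openSubsetIso ℤ ℤ c₂.open_source hy₂ k).hom
        ((localHomology.openSubsetIso ℤ ℤ c₂.open_source hy₂ k).inv z) = z := by
      rw [← ModuleCat.comp_apply, Iso.inv_hom_id, ModuleCat.id_apply]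
    conv_lhs => rw [← e1]
    rw [hS, ModuleCat.comp_apply, ← ModuleCat.comp_apply _ (localHomology.openSubsetIso ℤ ℤ
      c.open_source hy k).inv, Iso.hom_inv_id, ModuleCat.id_apply]
  -- naturality of the cross-universe transport for the square of inclusions
  have h2 := relativeSingularHomology.xEquiv_map ℤ ℤ c₂.toHomeomorphSourceTarget
    c.toHomeomorphSourceTarget ι ι' (fun v => rfl)
    (A := {(⟨y, hy₂⟩ : ↥c₂.source)}ᶜ) (B := {c₂.toHomeomorphSourceTarget ⟨y, hy₂⟩}ᶜ)
    (mapsTo_compl_singleton c₂.toHomeomorphSourceTarget.toEquiv ⟨y, hy₂⟩)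
    (mapsTo_symm_compl_singleton c₂.toHomeomorphSourceTarget.toEquiv ⟨y, hy₂⟩)
    (A₂ := {(⟨y, hy⟩ : ↥c.source)}ᶜ) (B₂ := {c.toHomeomorphSourceTarget ⟨y, hy⟩}ᶜ)
    (mapsTo_compl_singleton c.toHomeomorphSourceTarget.toEquiv ⟨y, hy⟩)
    (mapsTo_symm_compl_singleton c.toHomeomorphSourceTarget.toEquiv ⟨y, hy⟩) hι hι' k
    ((localHomology.openSubsetIso ℤ ℤ c₂.open_source hy₂ k).inv z)
  have e2 : (localHomology.openSubsetIso ℤ ℤ c.open_target (c.map_source hy) k).hom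
      (localHomology.xEquiv ℤ ℤ c.toHomeomorphSourceTarget ⟨y, hy⟩ k
        (relativeSingularHomology.map ℤ ℤ ι hι k
          ((localHomology.openSubsetIso ℤ ℤ c₂.open_source hy₂ k).inv z))) =
      (localHomology.openSubsetIso ℤ ℤ c.open_target (c.map_source hy) k).hom
        (relativeSingularHomology.map ℤ ℤ ι' hι' k
          (localHomology.xEquiv ℤ ℤ c₂.toHomeomorphSourceTarget ⟨y, hy₂⟩ k
            ((localHomology.openSubsetIso ℤ ℤ c₂.open_source hy₂ k).inv z))) :=
    congrArg (fun v => (localHomology.openSubsetIso ℤ ℤ c.open_target (c.map_source hy) k).hom v)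
      h2
  rw [eL, eR, h1, e2, hT]
  rfl

/-! ### Two charts at a point: the composite identification is the transition map -/

/-- **Two charts at a point.** For charts `c`, `c'` at `y`, the composite
`Hₙ(𝔼 | c' y) ≃ Hₙ(X | y) ≃ Hₙ(𝔼 | c y)` of the chart identifications equals the push-forward
along the transition map `t = c ∘ c'⁻¹` from the open part `c'(c.source ∩ c'.source)` of its
source, applied to the class excised to that open set (Hatcher 2002, §3.3 p. 231: local
homology is local; here across universes, by `relativeSingularHomology.xEquiv_map`).
[cite: HatcherAT2002, §3.3 p. 231] -/
theorem chartXEquiv_apply_chartXEquiv_symm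
    (c c' : OpenPartialHomeomorph X (EuclideanSpace ℝ (Fin n))) {y : X} (hy : y ∈ c.source)
    (hy' : y ∈ c'.source)
    (hp : c' y ∈ (c'.restrOpen c.source c.open_source).target)
    (h : MapsTo (fun v : ↥(c'.restrOpen c.source c.open_source).target => c (c'.symm v))
      {(⟨c' y, hp⟩ : ↥(c'.restrOpen c.source c.open_source).target)}ᶜ {c y}ᶜ)
    (w : localHomology ℤ ℤ (EuclideanSpace ℝ (Fin n)) (c' y) n) :
    localHomology.chartXEquiv ℤ ℤ c hy n ((localHomology.chartXEquiv ℤ ℤ c' hy' n).symm w) =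
      relativeSingularHomology.map ℤ ℤ
        (⟨fun v : ↥(c'.restrOpen c.source c.open_source).target => c (c'.symm v),
          (c.continuousOn.comp (c'.continuousOn_symm.mono inter_subset_left)
            (fun v (hv : v ∈ c'.target ∩ c'.symm ⁻¹' c.source) => hv.2)).restrict⟩ :
          C(↥(c'.restrOpen c.source c.open_source).target, EuclideanSpace ℝ (Fin n))) h n
        ((localHomology.openSubsetIso ℤ ℤ (c'.restrOpen c.source c.open_source).open_target
          hp n).inv w) := by
  -- shrink both charts to the common domain
  set c₂ := c.restrOpen c'.source c'.open_source with hc₂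
  set c'₂ := c'.restrOpen c.source c.open_source with hc'₂
  have hy₂ : y ∈ c₂.source := ⟨hy, hy'⟩
  have hy'₂ : y ∈ c'₂.source := ⟨hy', hy⟩
  rw [← chartXEquiv_restrOpen c c'.open_source hy hy' n]
  have hsymm : (localHomology.chartXEquiv ℤ ℤ c' hy' n).symm w =
      (localHomology.chartXEquiv ℤ ℤ c'₂ hy'₂ n).symm w := by
    apply (localHomology.chartXEquiv ℤ ℤ c' hy' n).injective
    rw [LinearEquiv.apply_symm_apply, ← chartXEquiv_restrOpen c' c.open_source hy' hy n,
      LinearEquiv.apply_symm_apply]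
  rw [hsymm]
  -- the inclusion `ι : S'₂ → S₂` and the transition `t̃ : T'₂ → T₂`
  let ι : C(↥c'₂.source, ↥c₂.source) :=
    ⟨Set.inclusion (fun v hv => ⟨hv.2, hv.1⟩), continuous_inclusion _⟩
  have hι : MapsTo ι {(⟨y, hy'₂⟩ : ↥c'₂.source)}ᶜ {(⟨y, hy₂⟩ : ↥c₂.source)}ᶜ := by
    intro v hv hv'
    apply hv
    rw [mem_singleton_iff] at hv' ⊢
    have e1 : (v : X) = y := congrArg Subtype.val hv'
    exact Subtype.ext e1
  have ht_mem : ∀ v : ↥c'₂.target, c (c'.symm v) ∈ c₂.target := fun v => by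
    refine ⟨c.map_source v.2.2, ?_⟩
    change c.symm (c (c'.symm v)) ∈ c'.source
    rw [c.left_inv v.2.2]
    exact c'.map_target v.2.1
  let t : C(↥c'₂.target, ↥c₂.target) :=
    ⟨fun v => ⟨c (c'.symm v), ht_mem v⟩,
      ((c.continuousOn.comp (c'.continuousOn_symm.mono inter_subset_left)
        (fun v (hv : v ∈ c'.target ∩ c'.symm ⁻¹' c.source) => hv.2)).restrict).subtype_mk _⟩
  have hfg : ∀ v : ↥c'₂.source, t (c'₂.toHomeomorphSourceTarget v) =
      c₂.toHomeomorphSourceTarget (ι v) := fun v => by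
    apply Subtype.ext
    change c (c'.symm (c' v)) = c v
    rw [c'.left_inv v.2.1]
  have ht : MapsTo t {c'₂.toHomeomorphSourceTarget ⟨y, hy'₂⟩}ᶜ
      {c₂.toHomeomorphSourceTarget ⟨y, hy₂⟩}ᶜ := by
    intro v hv hv'
    apply hv
    rw [mem_singleton_iff] at hv' ⊢
    apply c'₂.toHomeomorphSourceTarget.symm.injective
    rw [Homeomorph.symm_apply_apply]
    have h1 : c (c'.symm v) = c y := congrArg Subtype.val hv'
    apply Subtype.ext
    change c'.symm v = y
    exact c.injOn v.2.2 hy h1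
  -- unfold
  have eL : ∀ u, localHomology.chartXEquiv ℤ ℤ c₂ hy₂ n u =
      (localHomology.openSubsetIso ℤ ℤ c₂.open_target (c₂.map_source hy₂) n).hom
        (localHomology.xEquiv ℤ ℤ c₂.toHomeomorphSourceTarget ⟨y, hy₂⟩ n
          ((localHomology.openSubsetIso ℤ ℤ c₂.open_source hy₂ n).inv u)) := fun u => rfl
  have eS : (localHomology.chartXEquiv ℤ ℤ c'₂ hy'₂ n).symm w =
      (localHomology.openSubsetIso ℤ ℤ c'₂.open_source hy'₂ n).hom
        ((localHomology.xEquiv ℤ ℤ c'₂.toHomeomorphSourceTarget ⟨y, hy'₂⟩ n).symm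
          ((localHomology.openSubsetIso ℤ ℤ c'₂.open_target (c'₂.map_source hy'₂) n).inv w)) :=
    rfl
  -- `exc_{S₂}.inv ∘ exc_{S'₂}.hom = ι_*`
  have hS : (localHomology.openSubsetIso ℤ ℤ c'₂.open_source hy'₂ n).hom =
      relativeSingularHomology.map ℤ ℤ ι hι n ≫
        (localHomology.openSubsetIso ℤ ℤ c₂.open_source hy₂ n).hom :=
    relativeSingularHomology.map_comp ℤ ℤ ι (subsetIncl c₂.source) hι
      (localHomology.mapsTo_subsetIncl_compl hy₂) n
  have h1 : ∀ u, (localHomology.openSubsetIso ℤ ℤ c₂.open_source hy₂ n).inv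
      ((localHomology.openSubsetIso ℤ ℤ c'₂.open_source hy'₂ n).hom u) =
      relativeSingularHomology.map ℤ ℤ ι hι n u := fun u => by
    rw [hS, ModuleCat.comp_apply, ← ModuleCat.comp_apply _ (localHomology.openSubsetIso ℤ ℤ
      c₂.open_source hy₂ n).inv, Iso.hom_inv_id, ModuleCat.id_apply]
  -- naturality of the cross-universe transport for the square `(ι, t̃)`
  set v := (localHomology.xEquiv ℤ ℤ c'₂.toHomeomorphSourceTarget ⟨y, hy'₂⟩ n).symm
      ((localHomology.openSubsetIso ℤ ℤ c'₂.open_target (c'₂.map_source hy'₂) n).inv w) with hv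
  have h2 := relativeSingularHomology.xEquiv_map ℤ ℤ c'₂.toHomeomorphSourceTarget
    c₂.toHomeomorphSourceTarget ι t hfg
    (A := {(⟨y, hy'₂⟩ : ↥c'₂.source)}ᶜ) (B := {c'₂.toHomeomorphSourceTarget ⟨y, hy'₂⟩}ᶜ)
    (mapsTo_compl_singleton c'₂.toHomeomorphSourceTarget.toEquiv ⟨y, hy'₂⟩)
    (mapsTo_symm_compl_singleton c'₂.toHomeomorphSourceTarget.toEquiv ⟨y, hy'₂⟩)
    (A₂ := {(⟨y, hy₂⟩ : ↥c₂.source)}ᶜ) (B₂ := {c₂.toHomeomorphSourceTarget ⟨y, hy₂⟩}ᶜ)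
    (mapsTo_compl_singleton c₂.toHomeomorphSourceTarget.toEquiv ⟨y, hy₂⟩)
    (mapsTo_symm_compl_singleton c₂.toHomeomorphSourceTarget.toEquiv ⟨y, hy₂⟩) hι ht n v
  have e2 : (localHomology.openSubsetIso ℤ ℤ c₂.open_target (c₂.map_source hy₂) n).hom
      (localHomology.xEquiv ℤ ℤ c₂.toHomeomorphSourceTarget ⟨y, hy₂⟩ n
        (relativeSingularHomology.map ℤ ℤ ι hι n v)) =
      (localHomology.openSubsetIso ℤ ℤ c₂.open_target (c₂.map_source hy₂) n).hom
        (relativeSingularHomology.map ℤ ℤ t ht n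
          (localHomology.xEquiv ℤ ℤ c'₂.toHomeomorphSourceTarget ⟨y, hy'₂⟩ n v)) :=
    congrArg
      (fun u => (localHomology.openSubsetIso ℤ ℤ c₂.open_target (c₂.map_source hy₂) n).hom u) h2
  have e3 : localHomology.xEquiv ℤ ℤ c'₂.toHomeomorphSourceTarget ⟨y, hy'₂⟩ n v =
      (localHomology.openSubsetIso ℤ ℤ c'₂.open_target (c'₂.map_source hy'₂) n).inv w := by
    rw [hv, LinearEquiv.apply_symm_apply]
  -- `t̃_* ≫ exc_{T₂} = (c ∘ c'⁻¹)_*`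
  have e4 : relativeSingularHomology.map ℤ ℤ t ht n ≫
      (localHomology.openSubsetIso ℤ ℤ c₂.open_target (c₂.map_source hy₂) n).hom =
      relativeSingularHomology.map ℤ ℤ
        (⟨fun v : ↥(c'.restrOpen c.source c.open_source).target => c (c'.symm v),
          (c.continuousOn.comp (c'.continuousOn_symm.mono inter_subset_left)
            (fun v (hv : v ∈ c'.target ∩ c'.symm ⁻¹' c.source) => hv.2)).restrict⟩ :
          C(↥(c'.restrOpen c.source c.open_source).target, EuclideanSpace ℝ (Fin n))) h n :=
    (relativeSingularHomology.map_comp ℤ ℤ t (subsetIncl c₂.target) ht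
      (localHomology.mapsTo_subsetIncl_compl (c₂.map_source hy₂)) n).symm
  rw [eS, eL, h1, e2, e3]
  calc _ = (relativeSingularHomology.map ℤ ℤ t ht n ≫
        (localHomology.openSubsetIso ℤ ℤ c₂.open_target (c₂.map_source hy₂) n).hom)
        ((localHomology.openSubsetIso ℤ ℤ c'₂.open_target (c'₂.map_source hy'₂) n).inv w) :=
        rfl
    _ = _ := by rw [e4]; rfl

/-- **Change of chart is the sign of the Jacobian** (Bredon 1993, VI.7, Prop. 7.14;
Milnor–Stasheff 1974, App. A; Hatcher 2002, §3.3 p. 233): if the transition map `c ∘ c'⁻¹` of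
two charts at `y` is differentiable at `c' y` with Jacobian `A`, `det A ≠ 0`, then the
reference local class of `c'` at `y`, `(chartXEquiv c').symm (g (c' y))`, is sent by
`chartXEquiv c` to `g (c y)` if `det A > 0` and to `-g (c y)` if `det A < 0`.
[cite: Bredon1993, VI.7] -/
theorem chartXEquiv_apply_chartXEquiv_symm_localClass
    (g : HomologicalOrientation ℤ (EuclideanSpace ℝ (Fin n)) n)
    (c c' : OpenPartialHomeomorph X (EuclideanSpace ℝ (Fin n))) {y : X} (hy : y ∈ c.source)
    (hy' : y ∈ c'.source) {A : EuclideanSpace ℝ (Fin n) →L[ℝ] EuclideanSpace ℝ (Fin n)}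
    (hA : HasFDerivAt (fun v => c (c'.symm v)) A (c' y))
    (hdet : LinearMap.det (A : EuclideanSpace ℝ (Fin n) →ₗ[ℝ] EuclideanSpace ℝ (Fin n)) ≠ 0) :
    localHomology.chartXEquiv ℤ ℤ c hy n
        ((localHomology.chartXEquiv ℤ ℤ c' hy' n).symm (g.localClass (c' y))) =
      if 0 < LinearMap.det (A : EuclideanSpace ℝ (Fin n) →ₗ[ℝ] EuclideanSpace ℝ (Fin n))
      then g.localClass (c y) else -g.localClass (c y) := by
  have hp : c' y ∈ (c'.restrOpen c.source c.open_source).target := by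
    refine ⟨c'.map_source hy', ?_⟩
    change c'.symm (c' y) ∈ c.source
    rw [c'.left_inv hy']
    exact hy
  have hq : c (c'.symm (c' y)) = c y := by rw [c'.left_inv hy']
  have h : MapsTo (fun v : ↥(c'.restrOpen c.source c.open_source).target => c (c'.symm v))
      {(⟨c' y, hp⟩ : ↥(c'.restrOpen c.source c.open_source).target)}ᶜ {c y}ᶜ := by
    intro v hv hv'
    apply hv
    rw [mem_singleton_iff] at hv' ⊢
    apply Subtype.ext
    change (v : EuclideanSpace ℝ (Fin n)) = c' y
    have h1 : c'.symm v = y := c.injOn v.2.2 hy hv'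
    rw [← h1, c'.right_inv v.2.1]
  rw [chartXEquiv_apply_chartXEquiv_symm c c' hy hy' hp h]
  exact HomologicalOrientation.localDegree_of_hasFDerivAt g (fun v => c (c'.symm v))
    (c'.restrOpen c.source c.open_source).open_target hp
    (c.continuousOn.comp (c'.continuousOn_symm.mono inter_subset_left)
      (fun v (hv : v ∈ c'.target ∩ c'.symm ⁻¹' c.source) => hv.2)) hA hdet hq h

/-- **Change of chart is the sign of the Jacobian**, reference-class form: under the hypotheses
of `chartXEquiv_apply_chartXEquiv_symm_localClass`, the reference local classes at `y` of the
charts `c'` and `c` agree if `det A > 0` and are opposite if `det A < 0` (Bredon 1993, VI.7;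
Milnor–Stasheff 1974, App. A). [cite: Bredon1993, VI.7] -/
theorem chartXEquiv_symm_localClass_eq_of_hasFDerivAt
    (g : HomologicalOrientation ℤ (EuclideanSpace ℝ (Fin n)) n)
    (c c' : OpenPartialHomeomorph X (EuclideanSpace ℝ (Fin n))) {y : X} (hy : y ∈ c.source)
    (hy' : y ∈ c'.source) {A : EuclideanSpace ℝ (Fin n) →L[ℝ] EuclideanSpace ℝ (Fin n)}
    (hA : HasFDerivAt (fun v => c (c'.symm v)) A (c' y))
    (hdet : LinearMap.det (A : EuclideanSpace ℝ (Fin n) →ₗ[ℝ] EuclideanSpace ℝ (Fin n)) ≠ 0) :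
    (localHomology.chartXEquiv ℤ ℤ c' hy' n).symm (g.localClass (c' y)) =
      if 0 < LinearMap.det (A : EuclideanSpace ℝ (Fin n) →ₗ[ℝ] EuclideanSpace ℝ (Fin n))
      then (localHomology.chartXEquiv ℤ ℤ c hy n).symm (g.localClass (c y))
      else -(localHomology.chartXEquiv ℤ ℤ c hy n).symm (g.localClass (c y)) := by
  have key := chartXEquiv_apply_chartXEquiv_symm_localClass g c c' hy hy' hA hdet
  rw [← LinearEquiv.eq_symm_apply] at key
  rw [key]
  split_ifs
  · rfl
  · rw [map_neg]

/-! ### Along a fixed chart the reference classes are locally restrictions of one class -/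

/-- **Reference classes along a chart form a locally consistent family.** For a chart `c` at
`x` and a `ℤ`-orientation `g` of `𝔼`, there are a neighbourhood `K` of `x` (inside any given
`V ∈ 𝓝 x` and inside `c.source`) and a class `N ∈ Hₙ(X | K; ℤ)` whose restriction to every
`y ∈ K` is the reference class `(chartXEquiv c).symm (g (c y))`: a class `G` on a closed chart
ball inducing `g` (local consistency of `g`, Hatcher 2002, §3.3 p. 235) is excised to
`c.target`, transported across universes to `c.source` (`relativeSingularHomology.xEquiv`) and
pushed into `X`. No separation hypothesis on `X` is needed. [cite: HatcherAT2002, §3.3 p. 235] -/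
theorem exists_mem_nhds_restrictToPoint_eq_chartXEquiv_symm
    (g : HomologicalOrientation ℤ (EuclideanSpace ℝ (Fin n)) n)
    (c : OpenPartialHomeomorph X (EuclideanSpace ℝ (Fin n))) {x : X} (hx : x ∈ c.source)
    {V : Set X} (hV : V ∈ 𝓝 x) :
    ∃ K ∈ 𝓝 x, K ⊆ V ∧ ∃ hKc : K ⊆ c.source, ∃ N : localHomologyOfSet ℤ ℤ X K n,
      ∀ (y : X) (hy : y ∈ K), restrictToPoint ℤ ℤ hy n N =
        (localHomology.chartXEquiv ℤ ℤ c (hKc hy) n).symm (g.localClass (c y)) := by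
  -- a closed chart ball `K''` about `p = c x` carrying a class `G''` inducing `g`
  set p := c x with hp
  obtain ⟨K', hK', G, hG⟩ := g.locallyConsistent p
  obtain ⟨r, hr, hball⟩ := Metric.nhds_basis_closedBall.mem_iff.1
    (Filter.inter_mem hK' (c.open_target.mem_nhds (c.map_source hx)))
  have hK''K' : Metric.closedBall p r ⊆ K' := fun v hv => (hball hv).1
  have hcl : closure (Metric.closedBall p r) ⊆ c.target := by
    rw [Metric.isClosed_closedBall.closure_eq]; exact fun v hv => (hball hv).2
  set G'' := restrictLocal ℤ ℤ hK''K' n G with hG''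
  have hG''pt : ∀ (q : EuclideanSpace ℝ (Fin n)) (hq : q ∈ Metric.closedBall p r),
      restrictToPoint ℤ ℤ hq n G'' = g.localClass q := fun q hq => by
    rw [hG'', restrictToPoint_restrictLocal_apply, hG q (hK''K' hq)]
  -- excise to the chart target
  set excT := localHomologyOfSet.openSubsetIso ℤ ℤ c.open_target hcl n with hexcT
  set Ĝ := excT.inv G'' with hĜ
  -- the neighbourhood `K` and its traces `K̂ ⊆ c.source`, `B̂ ⊆ c.target`
  set K : Set X := (c.source ∩ c ⁻¹' Metric.ball p r) ∩ V with hK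
  have hKn : K ∈ 𝓝 x := Filter.inter_mem (Filter.inter_mem (c.open_source.mem_nhds hx)
    ((c.continuousAt hx).preimage_mem_nhds (Metric.ball_mem_nhds p hr))) hV
  have hKc : K ⊆ c.source := fun y hy => by rw [hK] at hy; exact hy.1.1
  set Khat : Set ↥c.source := {v | c v ∈ Metric.ball p r ∧ (v : X) ∈ V} with hKhat
  set Bhat : Set ↥c.target := {w | (w : EuclideanSpace ℝ (Fin n)) ∈ Metric.ball p r ∧
    c.symm w ∈ V} with hBhat
  have hBsub : Bhat ⊆ Subtype.val ⁻¹' Metric.closedBall p r := by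
    intro w hw
    rw [hBhat, mem_setOf_eq] at hw
    rw [mem_preimage]
    exact Metric.ball_subset_closedBall hw.1
  set ĜB := restrictLocal ℤ ℤ hBsub n Ĝ with hĜB
  -- transport across universes along `c : c.source ≃ₜ c.target`
  set h := c.toHomeomorphSourceTarget with hh
  have hAB : MapsTo h Khatᶜ Bhatᶜ := by
    intro v hv hv'
    rw [hBhat, mem_setOf_eq] at hv'
    rw [hKhat, mem_compl_iff, mem_setOf_eq] at hv
    apply hv
    refine ⟨hv'.1, ?_⟩
    have e1 : c.symm (c v) = v := c.left_inv v.2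
    have e2 : c.symm (h v) ∈ V := hv'.2
    change c.symm (c v) ∈ V at e2
    rwa [e1] at e2
  have hBA : MapsTo h.symm Bhatᶜ Khatᶜ := by
    intro w hw hw'
    rw [hKhat, mem_setOf_eq] at hw'
    rw [hBhat, mem_compl_iff, mem_setOf_eq] at hw
    apply hw
    have e1 : c (c.symm w) = w := c.right_inv w.2
    have e2 : c (h.symm w) ∈ Metric.ball p r := hw'.1
    change c (c.symm w) ∈ Metric.ball p r at e2
    rw [e1] at e2
    exact ⟨e2, hw'.2⟩
  set S := relativeSingularHomology.xEquiv ℤ ℤ h hAB hBA n with hS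
  set Gtil : localHomologyOfSet ℤ ℤ ↥c.source Khat n := S.symm ĜB with hGtil
  -- push into `X`
  have hj : MapsTo (subsetIncl c.source) Khatᶜ Kᶜ := by
    intro v hv hv'
    rw [hKhat, mem_compl_iff, mem_setOf_eq] at hv
    rw [hK] at hv'
    exact hv ⟨hv'.1.2, hv'.2⟩
  refine ⟨K, hKn, inter_subset_right, hKc,
    relativeSingularHomology.map ℤ ℤ (subsetIncl c.source) hj n Gtil, fun y hy => ?_⟩
  have hyU : y ∈ c.source := hKc hy
  have hy' : (y ∈ c.source ∧ c y ∈ Metric.ball p r) ∧ y ∈ V := by rw [hK] at hy; exact hy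
  have hŷ : (⟨y, hyU⟩ : ↥c.source) ∈ Khat := by
    rw [hKhat, mem_setOf_eq]; exact ⟨hy'.1.2, hy'.2⟩
  have hhŷ : h ⟨y, hyU⟩ ∈ Bhat := by
    rw [hBhat, mem_setOf_eq]
    refine ⟨hy'.1.2, ?_⟩
    change c.symm (c y) ∈ V
    rw [c.left_inv hyU]; exact hy'.2
  have hcy : c y ∈ Metric.closedBall p r := Metric.ball_subset_closedBall hy'.1.2
  -- Step 1: restrict in `X` = restrict in `c.source`, then excise
  have c1 : relativeSingularHomology.map ℤ ℤ (subsetIncl c.source) hj n ≫ restrictToPoint ℤ ℤ hy n =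
      restrictToPoint ℤ ℤ hŷ n ≫ (localHomology.openSubsetIso ℤ ℤ c.open_source hyU n).hom := by
    change relativeSingularHomology.map ℤ ℤ _ _ n ≫ relativeSingularHomology.map ℤ ℤ _ _ n =
      relativeSingularHomology.map ℤ ℤ _ _ n ≫ relativeSingularHomology.map ℤ ℤ _ _ n
    rw [← relativeSingularHomology.map_comp, ← relativeSingularHomology.map_comp]
    rfl
  -- Step 2: restriction commutes with the cross-universe transport
  have c2 := relativeSingularHomology.xEquiv_map ℤ ℤ h h (ContinuousMap.id _) (ContinuousMap.id _)
    (fun v => rfl) hAB hBA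
    (A₂ := {(⟨y, hyU⟩ : ↥c.source)}ᶜ) (B₂ := {c.toHomeomorphSourceTarget ⟨y, hyU⟩}ᶜ)
    (mapsTo_compl_singleton c.toHomeomorphSourceTarget.toEquiv ⟨y, hyU⟩)
    (mapsTo_symm_compl_singleton c.toHomeomorphSourceTarget.toEquiv ⟨y, hyU⟩)
    (fun v hv => compl_subset_compl.2 (singleton_subset_iff.2 hŷ) hv)
    (fun w hw => compl_subset_compl.2 (singleton_subset_iff.2 hhŷ) hw) n Gtil
  have c2' : restrictToPoint ℤ ℤ hŷ n Gtil =
      (localHomology.xEquiv ℤ ℤ c.toHomeomorphSourceTarget ⟨y, hyU⟩ n).symm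
        (restrictToPoint ℤ ℤ hhŷ n ĜB) := by
    rw [LinearEquiv.eq_symm_apply]
    change relativeSingularHomology.xEquiv ℤ ℤ h _ _ n
      (relativeSingularHomology.map ℤ ℤ (ContinuousMap.id _) _ n Gtil) = _
    rw [c2]
    change relativeSingularHomology.map ℤ ℤ (ContinuousMap.id _) _ n (S (S.symm ĜB)) = _
    rw [LinearEquiv.apply_symm_apply]
    rfl
  -- Step 3: restriction commutes with the excision to `c.target`
  have c3 : restrictToPoint ℤ ℤ (hBsub hhŷ) n ≫
      (localHomology.openSubsetIso ℤ ℤ c.open_target (c.map_source hyU) n).hom =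
      excT.hom ≫ restrictToPoint ℤ ℤ hcy n := by
    change relativeSingularHomology.map ℤ ℤ _ _ n ≫ relativeSingularHomology.map ℤ ℤ _ _ n =
      relativeSingularHomology.map ℤ ℤ _ _ n ≫ relativeSingularHomology.map ℤ ℤ _ _ n
    rw [← relativeSingularHomology.map_comp, ← relativeSingularHomology.map_comp]
    rfl
  have e1 : excT.hom Ĝ = G'' := by
    rw [hĜ, ← ModuleCat.comp_apply, Iso.inv_hom_id, ModuleCat.id_apply]
  have key : (localHomology.openSubsetIso ℤ ℤ c.open_target (c.map_source hyU) n).hom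
      (restrictToPoint ℤ ℤ hhŷ n ĜB) = g.localClass (c y) := by
    calc (localHomology.openSubsetIso ℤ ℤ c.open_target (c.map_source hyU) n).hom
          (restrictToPoint ℤ ℤ hhŷ n ĜB) =
        (localHomology.openSubsetIso ℤ ℤ c.open_target (c.map_source hyU) n).hom
          (restrictToPoint ℤ ℤ (hBsub hhŷ) n Ĝ) := by
          rw [hĜB, restrictToPoint_restrictLocal_apply]
      _ = (restrictToPoint ℤ ℤ (hBsub hhŷ) n ≫
          (localHomology.openSubsetIso ℤ ℤ c.open_target (c.map_source hyU) n).hom) Ĝ := rfl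
      _ = (excT.hom ≫ restrictToPoint ℤ ℤ hcy n) Ĝ := by rw [c3]
      _ = restrictToPoint ℤ ℤ hcy n (excT.hom Ĝ) := rfl
      _ = g.localClass (c y) := by rw [e1, hG''pt (c y) hcy]
  have c3' : restrictToPoint ℤ ℤ hhŷ n ĜB =
      (localHomology.openSubsetIso ℤ ℤ c.open_target (c.map_source hyU) n).inv
        (g.localClass (c y)) := by
    rw [← key, ← ModuleCat.comp_apply _ (localHomology.openSubsetIso ℤ ℤ c.open_target
      (c.map_source hyU) n).inv, Iso.hom_inv_id, ModuleCat.id_apply]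
  -- assemble
  rw [← ModuleCat.comp_apply, c1, ModuleCat.comp_apply, c2', c3']
  rfl

/-! ### Hausdorff case: agreement with the reference classes is locally constant -/

/-- The reference class of a chart at a point is a generator of `Hₙ(X | y; ℤ)`. [folklore] -/
theorem isGenerator_chartXEquiv_symm_localClass
    (g : HomologicalOrientation ℤ (EuclideanSpace ℝ (Fin n)) n)
    (c : OpenPartialHomeomorph X (EuclideanSpace ℝ (Fin n))) {y : X} (hy : y ∈ c.source) :
    ∃ e : localHomology ℤ ℤ X y n ≃ₗ[ℤ] ℤ,
      e ((localHomology.chartXEquiv ℤ ℤ c hy n).symm (g.localClass (c y))) = 1 :=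
  exists_linearEquiv_apply_eq_one_of_linearEquiv (localHomology.chartXEquiv ℤ ℤ c hy n).symm
    (g.isGenerator (c y))

/-- **On a Hausdorff space, agreement of a `ℤ`-orientation with the reference classes of a fixed
chart is locally constant** (Hatcher 2002, §3.3, Lemma 3.27 / p. 236: a section of the
orientation covering is determined near `x` by its value at `x`; here: both `μ` and the
reference family are, near `x`, restrictions of classes on a good chart ball `B`, and
`Hₙ(X | B) → Hₙ(X | x)` is injective, `isIso_restrictToPoint_of_convex_chart`). The Hausdorff
hypothesis is essential: on the line with two origins the statement fails.
[cite: HatcherAT2002, §3.3 Lemma 3.27] -/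
theorem HomologicalOrientation.eventually_localClass_eq_chartXEquiv_symm_iff [T2Space X]
    (μ : HomologicalOrientation ℤ X n) (g : HomologicalOrientation ℤ (EuclideanSpace ℝ (Fin n)) n)
    (c : OpenPartialHomeomorph X (EuclideanSpace ℝ (Fin n))) {x : X} (hx : x ∈ c.source) :
    ∀ᶠ y in 𝓝 x, ∃ hyc : y ∈ c.source,
      (μ.localClass y =
          (localHomology.chartXEquiv ℤ ℤ c hyc n).symm (g.localClass (c y)) ↔
        μ.localClass x =
          (localHomology.chartXEquiv ℤ ℤ c hx n).symm (g.localClass (c x))) := by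
  -- the two families as restrictions of classes on neighbourhoods `K₁`, `K₂`
  obtain ⟨K₁, hK₁, μK, hμK⟩ := μ.locallyConsistent x
  obtain ⟨K₂, hK₂, -, hK₂c, N, hN⟩ :=
    exists_mem_nhds_restrictToPoint_eq_chartXEquiv_symm g c hx Filter.univ_mem
  -- a good chart ball `B ⊆ K₁ ∩ K₂` about `x`
  set p := c x with hp
  have hsymm : c.symm p = x := c.left_inv hx
  have hpre : c.symm ⁻¹' (K₁ ∩ K₂) ∈ 𝓝 p :=
    (c.continuousAt_symm (c.map_source hx)).preimage_mem_nhds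
      (by rw [hsymm]; exact Filter.inter_mem hK₁ hK₂)
  obtain ⟨R, hR, hRsub⟩ := Metric.nhds_basis_closedBall.mem_iff.1
    (Filter.inter_mem (c.open_target.mem_nhds (c.map_source hx)) hpre)
  set B : Set X := c.source ∩ c ⁻¹' Metric.ball p (R / 4) with hB
  have hxB : x ∈ B := ⟨hx, Metric.mem_ball_self (by positivity)⟩
  have hBo : IsOpen B := c.isOpen_inter_preimage Metric.isOpen_ball
  have hBK : B ⊆ K₁ ∩ K₂ := fun y hy => by
    have h1 : c y ∈ Metric.closedBall p R :=
      (Metric.ball_subset_closedBall hy.2 |> Metric.closedBall_subset_closedBall (by linarith))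
    have h2 := (hRsub h1).2
    rw [mem_preimage, c.left_inv hy.1] at h2
    exact h2
  have hiso : ∀ (y : X) (hy : y ∈ B), IsIso (restrictToPoint ℤ ℤ hy n) := fun y hy =>
    isIso_restrictToPoint_of_convex_chart ℤ ℤ c (p := p) (r := R / 4) (by positivity)
      (by
        have : 4 * (R / 4) = R := by ring
        rw [this]; exact fun v hv => (hRsub hv).1)
      (convex_ball p (R / 4)) Metric.ball_subset_closedBall hB hy n
  -- the classes on `B`
  set α := restrictLocal ℤ ℤ (fun y hy => (hBK hy).1) n μK with hα
  set β := restrictLocal ℤ ℤ (fun y hy => (hBK hy).2) n N with hβ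
  have hαy : ∀ (y : X) (hy : y ∈ B), restrictToPoint ℤ ℤ hy n α = μ.localClass y :=
    fun y hy => by rw [hα, restrictToPoint_restrictLocal_apply, hμK y (hBK hy).1]
  have hβy : ∀ (y : X) (hy : y ∈ B), restrictToPoint ℤ ℤ hy n β =
      (localHomology.chartXEquiv ℤ ℤ c (hK₂c (hBK hy).2) n).symm (g.localClass (c y)) :=
    fun y hy => by rw [hβ, restrictToPoint_restrictLocal_apply, hN y (hBK hy).2]
  -- injectivity of the restriction at `x`
  have hinj : Function.Injective (restrictToPoint ℤ ℤ hxB n) := by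
    haveI := hiso x hxB
    exact (ModuleCat.mono_iff_injective (restrictToPoint ℤ ℤ hxB n)).1 inferInstance
  filter_upwards [hBo.mem_nhds hxB] with y hy
  refine ⟨hy.1, ?_⟩
  have hgen := isGenerator_chartXEquiv_symm_localClass g c hx
  rcases eq_or_eq_neg_of_isGenerator (μ.isGenerator x) hgen with h | h
  · -- `μ_x = R_x`: then `α = β` and `μ_y = R_y`
    have hab : α = β := hinj (by rw [hαy x hxB, hβy x hxB]; exact h)
    refine ⟨fun _ => h, fun _ => ?_⟩
    rw [← hαy y hy, hab, hβy y hy]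
  · -- `μ_x = -R_x`: then `α = -β`, `μ_y = -R_y ≠ R_y`
    have hab : α = -β := hinj (by rw [map_neg, hαy x hxB, hβy x hxB]; exact h)
    have hy' : μ.localClass y =
        -(localHomology.chartXEquiv ℤ ℤ c (hK₂c (hBK hy).2) n).symm (g.localClass (c y)) := by
      rw [← hαy y hy, hab, map_neg, hβy y hy]
    refine ⟨fun h' => ?_, fun h' => ?_⟩
    · exfalso
      have e : -(localHomology.chartXEquiv ℤ ℤ c (hK₂c (hBK hy).2) n).symm
          (g.localClass (c y)) =
          (localHomology.chartXEquiv ℤ ℤ c hy.1 n).symm (g.localClass (c y)) := hy'.symm.trans h'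
      exact neg_ne_self_of_isGenerator (isGenerator_chartXEquiv_symm_localClass g c hy.1) e
    · exfalso
      exact neg_ne_self_of_isGenerator hgen (h.symm.trans h')

end Charts

end Literature.AlgebraicTopology.SingularHomology
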